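import Summits.CriticalPhenomena.PercolationContinuityZ3.Theorems.PercNearOneGluingNoHeavyLowerTailSahiTransportRho

/-!
# `NoHeavyLowerTail` (crux stmt-CriticalPhenomena-4575), Sahi / Kahn positivity: TRANSPORT CERTIFICATES (V-a) —
# the last coordinate of the pattern cube `2^{Fin (k+1)}`: lifted patterns, sections of families, weights and probabilities

Support file (cell `prim-l12`, seat P3, gen 7; `--supports stmt-CriticalPhenomena-4575`).  No `sorry`, no named facts, standard axioms.
New mathematics (this programme; the tools of this file are folklore bookkeeping).

This is the section calculus used by `…SahiTransportAndLast` / `…SahiTransportCascade` to prove that the class of pattern events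
carrying a transport certificate (`…SahiTransportCert.TransportCert`) is closed under adjoining a fresh coordinate by `∧` and by `∨`:
* `lo S`, `hi S` — the two patterns of `Fin (k+1)` over a pattern `S` of `Fin k` (last coordinate closed / open), `rest`, the
  bijection `liftEquiv : 2^{Fin k} × Bool ≃ 2^{Fin (k+1)}` and the sum splitting `sum_set_succ`;
* `bw_lo`, `bw_hi` — `w(lo S) = w'(S)(1 − p)`, `w(hi S) = w'(S) p` (`p = q_k`, `w'` the weight of `q|_{Fin k}` = `qinit q`);
* `sec0 𝒳`, `sec1 𝒳` — the two sections of a family of patterns; for an up-set both are up-sets and `sec0 ⊆ sec1`;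
  `pr_eq_sec` : `μ(𝒳) = (1 − p) μ'(sec₀ 𝒳) + p μ'(sec₁ 𝒳)`;
* small tools on the `k`-cube: `pattern_cases`, `pr_compl_inter`, the nonnegative mixed second difference
  `pr_inter_second_diff_nonneg`, and two one-point sums. [this work]
-/

noncomputable section

open scoped Classical

namespace Summit.CriticalPhenomena.PercolationContinuityZ3.Theorems

namespace SahiTransportCert

open Finset
open SahiHittingSlot
open Literature.Combinatorics.Sahi2008
open Literature.Probability.Percolation.BHK2006 (weight)
open Literature.Probability.Percolation.DecisionTree (ind ind_of_mem ind_of_not_mem ind_nonneg)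

variable {k : ℕ}

/-! ### The last coordinate: lifting patterns of `Fin k` to `Fin (k+1)` -/

/-- The pattern of `Fin (k+1)` with `Fin k`-part `S` and the last coordinate CLOSED. [this work] -/
def lo (S : Set (Fin k)) : Set (Fin (k + 1)) := Fin.castSucc '' S

/-- The pattern of `Fin (k+1)` with `Fin k`-part `S` and the last coordinate OPEN. [this work] -/
def hi (S : Set (Fin k)) : Set (Fin (k + 1)) := insert (Fin.last k) (lo S)

/-- The `Fin k`-part of a pattern of `Fin (k+1)`. [this work] -/
def rest (S : Set (Fin (k + 1))) : Set (Fin k) := Fin.castSucc ⁻¹' S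

/-- Membership of an old coordinate in `lo S`. [this work] -/
@[simp] theorem castSucc_mem_lo {S : Set (Fin k)} {i : Fin k} : Fin.castSucc i ∈ lo S ↔ i ∈ S :=
  Fin.castSucc_injective k |>.mem_set_image

/-- The last coordinate is closed in `lo S`. [this work] -/
@[simp] theorem last_not_mem_lo (S : Set (Fin k)) : Fin.last k ∉ lo S := by
  rintro ⟨i, -, h⟩; exact (Fin.castSucc_lt_last i).ne h

/-- Membership of an old coordinate in `hi S`. [this work] -/
@[simp] theorem castSucc_mem_hi {S : Set (Fin k)} {i : Fin k} : Fin.castSucc i ∈ hi S ↔ i ∈ S := by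
  rw [hi, Set.mem_insert_iff, castSucc_mem_lo, or_iff_right (Fin.castSucc_lt_last i).ne]

/-- The last coordinate is open in `hi S`. [this work] -/
@[simp] theorem last_mem_hi (S : Set (Fin k)) : Fin.last k ∈ hi S := Set.mem_insert _ _

/-- `rest (lo S) = S`. [this work] -/
@[simp] theorem rest_lo (S : Set (Fin k)) : rest (lo S) = S := by ext i; simp [rest]

/-- `rest (hi S) = S`. [this work] -/
@[simp] theorem rest_hi (S : Set (Fin k)) : rest (hi S) = S := by ext i; simp [rest]

/-- Membership in `rest`. [this work] -/
@[simp] theorem mem_rest {S : Set (Fin (k + 1))} {i : Fin k} : i ∈ rest S ↔ Fin.castSucc i ∈ S := Iff.rfl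

/-- A pattern with the last coordinate closed is `lo` of its rest. [this work] -/
theorem eq_lo_rest {S : Set (Fin (k + 1))} (h : Fin.last k ∉ S) : S = lo (rest S) := by
  ext i
  induction i using Fin.lastCases with
  | last => simp only [last_not_mem_lo, iff_false]; exact h
  | cast j => simp

/-- A pattern with the last coordinate open is `hi` of its rest. [this work] -/
theorem eq_hi_rest {S : Set (Fin (k + 1))} (h : Fin.last k ∈ S) : S = hi (rest S) := by
  ext i
  induction i using Fin.lastCases with
  | last => simp only [last_mem_hi, iff_true]; exact h
  | cast j => simp

/-- `lo` is injective. [this work] -/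
theorem lo_injective : Function.Injective (lo (k := k)) := fun S T h => by rw [← rest_lo S, h, rest_lo]

/-- `hi` is injective. [this work] -/
theorem hi_injective : Function.Injective (hi (k := k)) := fun S T h => by rw [← rest_hi S, h, rest_hi]

/-- `lo S ≠ hi T`. [this work] -/
theorem lo_ne_hi (S T : Set (Fin k)) : lo S ≠ hi T := fun h => last_not_mem_lo S (h ▸ last_mem_hi T)

/-- `lo S ⊆ lo T ↔ S ⊆ T`. [this work] -/
theorem lo_subset_lo {S T : Set (Fin k)} : lo S ⊆ lo T ↔ S ⊆ T :=
  ⟨fun h _ hi' => castSucc_mem_lo.1 (h (castSucc_mem_lo.2 hi')), fun h => Set.image_mono h⟩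

/-- `hi S ⊆ hi T ↔ S ⊆ T`. [this work] -/
theorem hi_subset_hi {S T : Set (Fin k)} : hi S ⊆ hi T ↔ S ⊆ T :=
  ⟨fun h _ hi' => castSucc_mem_hi.1 (h (castSucc_mem_hi.2 hi')), fun h => Set.insert_subset_insert (Set.image_mono h)⟩

/-- `lo S ⊆ hi T ↔ S ⊆ T`. [this work] -/
theorem lo_subset_hi {S T : Set (Fin k)} : lo S ⊆ hi T ↔ S ⊆ T :=
  ⟨fun h _ hi' => castSucc_mem_hi.1 (h (castSucc_mem_lo.2 hi')), fun h => (lo_subset_lo.2 h).trans (Set.subset_insert _ _)⟩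

/-- `hi S` is never below `lo T`. [this work] -/
theorem not_hi_subset_lo (S T : Set (Fin k)) : ¬ hi S ⊆ lo T := fun h => last_not_mem_lo T (h (last_mem_hi S))

/-- `lo S ⊆ hi S`. [this work] -/
theorem lo_subset_hi_self (S : Set (Fin k)) : lo S ⊆ hi S := lo_subset_hi.2 subset_rfl

/-- The patterns of `Fin (k+1)` are the `lo S` and the `hi S`: `2^{Fin (k+1)} ≃ 2^{Fin k} × Bool`. [this work] -/
def liftEquiv : Set (Fin k) × Bool ≃ Set (Fin (k + 1)) where
  toFun x := if x.2 then hi x.1 else lo x.1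
  invFun S := (rest S, decide (Fin.last k ∈ S))
  left_inv := by
    rintro ⟨S, b⟩
    cases b <;> simp
  right_inv S := by
    by_cases h : Fin.last k ∈ S
    · simp only [h, decide_true, if_true]; exact (eq_hi_rest h).symm
    · simp only [h, decide_false]; exact (eq_lo_rest h).symm

/-- **Splitting a sum over the patterns of `Fin (k+1)` by the last coordinate.** [this work] -/
theorem sum_set_succ (F : Set (Fin (k + 1)) → ℝ) : ∑ S, F S = ∑ S : Set (Fin k), (F (lo S) + F (hi S)) := by
  rw [← Fintype.sum_equiv liftEquiv (fun x => F (liftEquiv x)) F (fun _ => rfl), Fintype.sum_prod_type]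
  refine sum_congr rfl fun S _ => ?_
  rw [Fintype.sum_bool]
  simp [liftEquiv, add_comm]

/-! ### Weights and probabilities through the last coordinate -/

section Params

variable (q : Fin (k + 1) → unitInterval)

/-- The parameters of the first `k` coordinates. [this work] -/
def qinit : Fin k → unitInterval := fun i => q (Fin.castSucc i)

/-- The parameter of the last coordinate, as a real number. [this work] -/
def plast : ℝ := (q (Fin.last k) : ℝ)

/-- `0 ≤ p`. [this work] -/
theorem plast_nonneg : 0 ≤ plast q := p_nonneg q _

/-- `p ≤ 1`. [this work] -/
theorem plast_le_one : plast q ≤ 1 := p_le_one q _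

/-- `w(lo S) = w'(S)·(1 − p)`. [this work] -/
theorem bw_lo (S : Set (Fin k)) : bernoulliWeight q (lo S) = bernoulliWeight (qinit q) S * (1 - plast q) := by
  change (∏ e, (if e ∈ lo S then (q e : ℝ) else 1 - (q e : ℝ))) =
    (∏ i, (if i ∈ S then (q (Fin.castSucc i) : ℝ) else 1 - (q (Fin.castSucc i) : ℝ))) * (1 - (q (Fin.last k) : ℝ))
  rw [Fin.prod_univ_castSucc]
  simp only [castSucc_mem_lo, last_not_mem_lo, if_false]

/-- `w(hi S) = w'(S)·p`. [this work] -/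
theorem bw_hi (S : Set (Fin k)) : bernoulliWeight q (hi S) = bernoulliWeight (qinit q) S * plast q := by
  change (∏ e, (if e ∈ hi S then (q e : ℝ) else 1 - (q e : ℝ))) =
    (∏ i, (if i ∈ S then (q (Fin.castSucc i) : ℝ) else 1 - (q (Fin.castSucc i) : ℝ))) * (q (Fin.last k) : ℝ)
  rw [Fin.prod_univ_castSucc]
  simp only [castSucc_mem_hi, last_mem_hi, if_true]

/-- The section of a family of patterns at "last coordinate closed". [this work] -/
def sec0 (𝒳 : Set (Set (Fin (k + 1)))) : Set (Set (Fin k)) := {S | lo S ∈ 𝒳}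

/-- The section of a family of patterns at "last coordinate open". [this work] -/
def sec1 (𝒳 : Set (Set (Fin (k + 1)))) : Set (Set (Fin k)) := {S | hi S ∈ 𝒳}

omit q in
/-- Membership in `sec0`. [this work] -/
@[simp] theorem mem_sec0 {𝒳 : Set (Set (Fin (k + 1)))} {S : Set (Fin k)} : S ∈ sec0 𝒳 ↔ lo S ∈ 𝒳 := Iff.rfl

omit q in
/-- Membership in `sec1`. [this work] -/
@[simp] theorem mem_sec1 {𝒳 : Set (Set (Fin (k + 1)))} {S : Set (Fin k)} : S ∈ sec1 𝒳 ↔ hi S ∈ 𝒳 := Iff.rfl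

omit q in
/-- Sections commute with intersection. [this work] -/
theorem sec0_inter (𝒳 𝒵 : Set (Set (Fin (k + 1)))) : sec0 (𝒳 ∩ 𝒵) = sec0 𝒳 ∩ sec0 𝒵 := rfl

omit q in
/-- Sections commute with intersection. [this work] -/
theorem sec1_inter (𝒳 𝒵 : Set (Set (Fin (k + 1)))) : sec1 (𝒳 ∩ 𝒵) = sec1 𝒳 ∩ sec1 𝒵 := rfl

omit q in
/-- Sections commute with complement. [this work] -/
theorem sec0_compl (𝒳 : Set (Set (Fin (k + 1)))) : sec0 𝒳ᶜ = (sec0 𝒳)ᶜ := rfl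

omit q in
/-- Sections commute with complement. [this work] -/
theorem sec1_compl (𝒳 : Set (Set (Fin (k + 1)))) : sec1 𝒳ᶜ = (sec1 𝒳)ᶜ := rfl

omit q in
/-- Sections of an up-set are up-sets. [this work] -/
theorem isUpperSet_sec0 {𝒳 : Set (Set (Fin (k + 1)))} (h : IsUpperSet 𝒳) : IsUpperSet (sec0 𝒳) :=
  fun _ _ hle hS => h (lo_subset_lo.2 hle) hS

omit q in
/-- Sections of an up-set are up-sets. [this work] -/
theorem isUpperSet_sec1 {𝒳 : Set (Set (Fin (k + 1)))} (h : IsUpperSet 𝒳) : IsUpperSet (sec1 𝒳) :=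
  fun _ _ hle hS => h (hi_subset_hi.2 hle) hS

omit q in
/-- For an up-set the closed section lies inside the open section. [this work] -/
theorem sec0_subset_sec1 {𝒳 : Set (Set (Fin (k + 1)))} (h : IsUpperSet 𝒳) : sec0 𝒳 ⊆ sec1 𝒳 :=
  fun S hS => h (lo_subset_hi_self S) hS

omit q in
/-- Indicators through the sections. [this work] -/
theorem ind_lo (𝒳 : Set (Set (Fin (k + 1)))) (S : Set (Fin k)) : ind 𝒳 (lo S) = ind (sec0 𝒳) S := by
  by_cases h : lo S ∈ 𝒳
  · rw [ind_of_mem h, ind_of_mem (show S ∈ sec0 𝒳 from h)]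
  · rw [ind_of_not_mem h, ind_of_not_mem (show S ∉ sec0 𝒳 from h)]

omit q in
/-- Indicators through the sections. [this work] -/
theorem ind_hi (𝒳 : Set (Set (Fin (k + 1)))) (S : Set (Fin k)) : ind 𝒳 (hi S) = ind (sec1 𝒳) S := by
  by_cases h : hi S ∈ 𝒳
  · rw [ind_of_mem h, ind_of_mem (show S ∈ sec1 𝒳 from h)]
  · rw [ind_of_not_mem h, ind_of_not_mem (show S ∉ sec1 𝒳 from h)]

/-- **Probabilities through the last coordinate**: `μ(𝒳) = (1−p)·μ'(sec₀ 𝒳) + p·μ'(sec₁ 𝒳)`. [this work] -/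
theorem pr_eq_sec (𝒳 : Set (Set (Fin (k + 1)))) :
    pr q 𝒳 = (1 - plast q) * pr (qinit q) (sec0 𝒳) + plast q * pr (qinit q) (sec1 𝒳) := by
  rw [pr_eq_sum, sum_set_succ, pr_eq_sum, pr_eq_sum, mul_sum, mul_sum, ← sum_add_distrib]
  refine sum_congr rfl fun S _ => ?_
  rw [bw_lo, bw_hi, ind_lo, ind_hi]
  ring

end Params

/-! ### Small tools on the `k`-cube -/

section Tools

variable (q' : Fin k → unitInterval)

/-- Every pattern of `Fin (k+1)` is a `lo S` or a `hi S`. [this work] -/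
theorem pattern_cases {P : Set (Fin (k + 1)) → Prop} (h0 : ∀ S, P (lo S)) (h1 : ∀ S, P (hi S)) (S : Set (Fin (k + 1))) : P S := by
  by_cases h : Fin.last k ∈ S
  · rw [eq_hi_rest h]; exact h1 _
  · rw [eq_lo_rest h]; exact h0 _

/-- `μ(Hᶜ ∩ Y) = μ(Y) − μ(H ∩ Y)`. [this work] -/
theorem pr_compl_inter (H Y : Set (Set (Fin k))) : pr q' (Hᶜ ∩ Y) = pr q' Y - pr q' (H ∩ Y) := by
  rw [pr_eq_sum, pr_eq_sum, pr_eq_sum, ← sum_sub_distrib]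
  refine sum_congr rfl fun T _ => ?_
  by_cases hH : T ∈ H <;> by_cases hY : T ∈ Y <;>
    simp [ind_of_mem, ind_of_not_mem, hH, hY, Set.mem_inter_iff, Set.mem_compl_iff]

/-- The mixed second difference of `μ(H ∩ · ∩ ·)` over nested pairs is nonnegative:
`μ(H∩X₁∩Z₁) − μ(H∩X₀∩Z₁) − μ(H∩X₁∩Z₀) + μ(H∩X₀∩Z₀) ≥ 0` for `X₀ ⊆ X₁`, `Z₀ ⊆ Z₁`. [this work] -/
theorem pr_inter_second_diff_nonneg (H : Set (Set (Fin k))) {X₀ X₁ Z₀ Z₁ : Set (Set (Fin k))} (hX : X₀ ⊆ X₁) (hZ : Z₀ ⊆ Z₁) :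
    0 ≤ pr q' (H ∩ (X₁ ∩ Z₁)) - pr q' (H ∩ (X₀ ∩ Z₁)) - pr q' (H ∩ (X₁ ∩ Z₀)) + pr q' (H ∩ (X₀ ∩ Z₀)) := by
  rw [pr_eq_sum, pr_eq_sum, pr_eq_sum, pr_eq_sum, ← sum_sub_distrib, ← sum_sub_distrib, ← sum_add_distrib]
  refine sum_nonneg fun T _ => ?_
  have hw := bw_nonneg q' T
  have e : bernoulliWeight q' T * ind (H ∩ (X₁ ∩ Z₁)) T - bernoulliWeight q' T * ind (H ∩ (X₀ ∩ Z₁)) T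
      - bernoulliWeight q' T * ind (H ∩ (X₁ ∩ Z₀)) T + bernoulliWeight q' T * ind (H ∩ (X₀ ∩ Z₀)) T =
      bernoulliWeight q' T * (ind H T * ((ind X₁ T - ind X₀ T) * (ind Z₁ T - ind Z₀ T))) := by
    simp only [Literature.Probability.Percolation.BHK2006.ind_inter]; ring
  rw [e]
  refine mul_nonneg hw (mul_nonneg (ind_nonneg H T) (mul_nonneg ?_ ?_))
  · exact sub_nonneg.2 (ind_le_ind_of_imp fun h => hX h)
  · exact sub_nonneg.2 (ind_le_ind_of_imp fun h => hZ h)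

/-- A sum of a function supported at one pattern. [this work] -/
theorem sum_ite_eq_and (S : Set (Fin k)) (c : Prop) [Decidable c] (a : ℝ) :
    ∑ T : Set (Fin k), (if T = S ∧ c then a else 0) = if c then a else 0 := by
  have : ∀ T : Set (Fin k), (if T = S ∧ c then a else 0) = if T = S then (if c then a else 0) else 0 := by
    intro T; by_cases hT : T = S <;> by_cases hc : c <;> simp [hT, hc]
  simp_rw [this]
  rw [Finset.sum_ite_eq' Finset.univ S]; simp

/-- A sum of a function supported at one pattern (dependent form). [this work] -/
theorem sum_ite_eq_and' (T : Set (Fin k)) (P : Set (Fin k) → Prop) [DecidablePred P] (a : Set (Fin k) → ℝ) :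
    ∑ S : Set (Fin k), (if T = S ∧ P S then a S else 0) = if P T then a T else 0 := by
  have : ∀ S : Set (Fin k), (if T = S ∧ P S then a S else 0) = if T = S then (if P S then a S else 0) else 0 := by
    intro S; by_cases hT : T = S <;> by_cases hc : P S <;> simp [hT, hc]
  simp_rw [this]
  rw [Finset.sum_ite_eq Finset.univ T]; simp

end Tools

end SahiTransportCert

end Summit.CriticalPhenomena.PercolationContinuityZ3.Theorems
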